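import Summits.Ventures.PercRepro.Night2ThreeTwoFiberAll

/-!
# PercRepro — the cell `(2, 1)`: the basis pairs' inequality from a count of the lossy covering bases
(night-2, gen 27)

The `ρ = 5` twin of `basis_pair_fair_of_qSumC` (`Night2ThreeTwoCountAssembly`), with the capacity floors and the
column bound as inputs: for a lossy basis pair `(B, z)` of a flat of the cell `(2, 1)` (`d = 2`, one coloop, `P` = the
big members `|B ∖ K| ≥ 5`), if the non-`P` mass of every target is at most `cnt (i, j) · E/D` in terms of its profile
`(i, j) = (|T′ ∩ X|, |T′ ∖ X|)` along a set `X ⊆ V` (`D = 2^{n−5} − 1`), the capacity `cap3` of every target is at least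
`v |T′|`, and `1 ≤ qSumV |X| |V ∖ X| i₀ j₀ E cnt v`, then `loss B z ≤ rhoL B z · lossIncomeH B z`.

* `qSumV L y i₀ j₀ E cnt v`: the count sum with an arbitrary floor `v`;
* **`basis_pair_fair_of_qSumV_two_one`**: the inequality.
-/

namespace PercRepro.Shadow

open Finset PerFlat ThmH

variable {α : Type*} [DecidableEq α] {M : Matroid α} [M.Finite]

/-- The count sum of a basis pair of profile `(i₀, j₀)` along a set with `L` points and `y` points off it, with a
capacity floor `v` of the target size: over the profiles `(i, j)` of its targets, the number of targets of that profile
times `v (i + j)` over `cnt i j · E`. -/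
def qSumV (L y i₀ j₀ : ℕ) (E : ℚ) (cnt : ℕ → ℕ → ℕ) (v : ℕ → ℚ) : ℚ :=
  ∑ i ∈ Finset.range (L + 1), ∑ j ∈ Finset.range (y + 1),
    if i₀ ≤ i ∧ j₀ ≤ j ∧ (i, j) ≠ (i₀, j₀) then
      ((L - i₀).choose (i - i₀) * (y - j₀).choose (j - j₀) : ℚ) * (v (i + j) / ((cnt i j : ℚ) * E))
    else 0

section TwoOneAssembly

variable {G : Finset α}

open scoped Classical in
/-- **THE BASIS PAIRS' INEQUALITY FROM A COUNT SUM** (cell `(2, 1)`, `|V| ≥ 6`, `P` = the big members, the column bound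
and the capacity floors as inputs). -/
theorem basis_pair_fair_of_qSumV_two_one (hG : G ∈ flatsQ M (5 + 1)) (hd : (gr M \ G).card = 2)
    (hk : kColoops M G = 1) (h6 : 6 ≤ (G \ coloops M G).card) {X : Finset α} (hXV : X ⊆ G \ coloops M G)
    {cnt : ℕ → ℕ → ℕ} {v : ℕ → ℚ} (hv0 : ∀ s, 0 ≤ v s) {E : ℚ} (hE : 0 < E)
    (hdl : ∀ S ∈ shadowAt M (5 + 2) 5 (Uq M (5 + 2) 5) G,
      dload M 5 G (fun B => 5 ≤ (B \ coloops M G).card) (dshMissed M 5 G) S ≤ cap2 M 5 G S)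
    {B : Finset α} (hB : B ∈ thinMembers M 5 G) (hnP : ¬ (5 ≤ (B \ coloops M G).card)) {z : α}
    (hz : z ∈ G \ clF M B) (hl0 : loss M 5 G B z ≠ 0)
    (hcnt : ∀ T ∈ tgtSets M 5 G B z, pi2MassH M 5 G (fun B => 5 ≤ (B \ coloops M G).card) T ≤
      ((cnt (profileAt (coloops M G) X T).1 (profileAt (coloops M G) X T).2 : ℕ) : ℚ) *
        (E / ((2 ^ ((G \ coloops M G).card - 5) - 1 : ℕ) : ℚ)))
    (hcap : ∀ T ∈ tgtSets M 5 G B z, v (T \ coloops M G).card ≤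
      cap3 M 5 G (fun B => 5 ≤ (B \ coloops M G).card) (dshMissed M 5 G) T)
    (hsum : 1 ≤ qSumV X.card ((G \ coloops M G) \ X).card (profileAt (coloops M G) X (insert z B)).1
      (profileAt (coloops M G) X (insert z B)).2 E cnt v) :
    loss M 5 G B z ≤ rhoL M 5 G B z *
      lossIncomeH M 5 G (fun B => 5 ≤ (B \ coloops M G).card) (dshMissed M 5 G) B z := by
  have hd' : (gr M \ G).card ≤ 5 := by omega
  have hk' : kColoops M G + 5 = 5 + 1 := by omega
  have hB' : B ∈ membersIn M (Uq M (5 + 2) 5) G := (mem_thinMembers.1 hB).1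
  have hKG : coloops M G ⊆ G := fun y hy => (mem_coloops.1 hy).1
  have hB4 : (B \ coloops M G).card + 1 = 5 := by
    have := card_sdiff_coloops_thin_ge hG hd' hk' hB
    omega
  set n := (G \ coloops M G).card with hn
  have hGn : G.card - kColoops M G = n := by
    rw [hn, Finset.card_sdiff_of_subset hKG, kColoops_eq_card_coloops]
  have hr : (G \ insert z B).card = n - 5 := by
    rw [card_sdiff_insert_eq_dqm1 hG hd' hB hB4 hz, hGn]
  set D : ℚ := ((2 ^ (n - 5) - 1 : ℕ) : ℚ) with hD
  have hDpos : 0 < D := by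
    rw [hD]
    have : 2 ≤ 2 ^ (n - 5) := by
      calc 2 = 2 ^ 1 := by norm_num
        _ ≤ 2 ^ (n - 5) := Nat.pow_le_pow_right (by norm_num) (by omega)
    exact_mod_cast (by omega : 0 < 2 ^ (n - 5) - 1)
  have hT : ((tgtSets M 5 G B z).card : ℚ) = D := by
    rw [card_tgtSets hG hB' hz, hr]
  have hrho : rhoL M 5 G B z = loss M 5 G B z / D := by
    unfold rhoL; rw [hT]
  set 𝒯 := tgtSets M 5 G B z with h𝒯def
  have hprof : ∀ T ∈ 𝒯, (profileAt (coloops M G) X T).1 + (profileAt (coloops M G) X T).2 =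
      (T \ coloops M G).card := by
    intro T _
    simp only [profileAt]
    rw [add_comm, Finset.card_sdiff_add_card_inter]
  set u : Finset α → ℚ := fun T =>
    ((cnt (profileAt (coloops M G) X T).1 (profileAt (coloops M G) X T).2 : ℕ) : ℚ) * (E / D) with hu_def
  set vT : Finset α → ℚ := fun T => v (T \ coloops M G).card with hv_def
  have hu : ∀ T ∈ 𝒯, pi2MassH M 5 G (fun B => 5 ≤ (B \ coloops M G).card) T ≤ u T := fun T hT => hcnt T hT
  have hv : ∀ T ∈ 𝒯, vT T ≤ cap3 M 5 G (fun B => 5 ≤ (B \ coloops M G).card) (dshMissed M 5 G) T :=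
    fun T hT => hcap T hT
  have hv0' : ∀ T ∈ 𝒯, 0 ≤ vT T := fun T _ => hv0 _
  have hinc := lossIncomeH_ge_of_subfamily hG hd' hdl hB hnP hz hl0 (Finset.Subset.refl 𝒯) u vT hu hv hv0'
  set F : ℕ × ℕ → ℚ := fun p => v (p.1 + p.2) / ((cnt p.1 p.2 : ℚ) * E) with hF_def
  have hF0 : ∀ p, 0 ≤ F p := fun p => div_nonneg (hv0 _) (mul_nonneg (by positivity) hE.le)
  have hsum1 : ∑ T ∈ 𝒯, vT T / u T = D * ∑ T ∈ 𝒯, F (profileAt (coloops M G) X T) := by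
    rw [Finset.mul_sum]
    apply Finset.sum_congr rfl
    intro T hT
    simp only [hu_def, hv_def, hF_def]
    rw [← hprof T hT]
    by_cases hm : (cnt (profileAt (coloops M G) X T).1 (profileAt (coloops M G) X T).2 : ℚ) = 0
    · simp only [hm, zero_mul, div_zero, mul_zero]
    · field_simp
  set t : Finset (ℕ × ℕ) := (Finset.range (X.card + 1)) ×ˢ (Finset.range (((G \ coloops M G) \ X).card + 1))
    with ht_def
  have hfib : ∑ p ∈ t, ∑ T ∈ 𝒯.filter (fun T => profileAt (coloops M G) X T = p), F (profileAt (coloops M G) X T) ≤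
      ∑ T ∈ 𝒯, F (profileAt (coloops M G) X T) := by
    apply Finset.sum_fiberwise_le_sum_of_sum_fiber_nonneg
    intro p _
    exact Finset.sum_nonneg (fun T _ => hF0 _)
  have hfib' : ∀ p ∈ t, ∑ T ∈ 𝒯.filter (fun T => profileAt (coloops M G) X T = p), F (profileAt (coloops M G) X T) =
      ((𝒯.filter (fun T => profileAt (coloops M G) X T = p)).card : ℚ) * F p := by
    intro p _
    rw [← nsmul_eq_mul, ← Finset.sum_const]
    apply Finset.sum_congr rfl
    intro T hT
    rw [(Finset.mem_filter.1 hT).2]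
  set i₀ := (profileAt (coloops M G) X (insert z B)).1 with hi₀
  set j₀ := (profileAt (coloops M G) X (insert z B)).2 with hj₀
  have hq : qSumV X.card ((G \ coloops M G) \ X).card i₀ j₀ E cnt v =
      ∑ p ∈ t, if i₀ ≤ p.1 ∧ j₀ ≤ p.2 ∧ p ≠ (i₀, j₀) then
        ((X.card - i₀).choose (p.1 - i₀) * (((G \ coloops M G) \ X).card - j₀).choose (p.2 - j₀) : ℚ) * F p
      else 0 := by
    unfold qSumV
    rw [ht_def, Finset.sum_product]
  have hge : ∀ p ∈ t, (if i₀ ≤ p.1 ∧ j₀ ≤ p.2 ∧ p ≠ (i₀, j₀) then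
        ((X.card - i₀).choose (p.1 - i₀) * (((G \ coloops M G) \ X).card - j₀).choose (p.2 - j₀) : ℚ) * F p
      else 0) ≤ ((𝒯.filter (fun T => profileAt (coloops M G) X T = p)).card : ℚ) * F p := by
    intro p _
    split_ifs with hcond
    · apply mul_le_mul_of_nonneg_right _ (hF0 p)
      obtain ⟨hi, hj, hne⟩ := hcond
      have hne' : (p.1, p.2) ≠ profileAt (coloops M G) X (insert z B) := by
        intro h
        apply hne
        rw [hi₀, hj₀, Prod.mk.eta, ← h, Prod.mk.eta]
      have := card_fiber_ge_choose_mul_choose_all hG hd' hB hz hXV hne' hi hj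
      exact_mod_cast this
    · exact mul_nonneg (by positivity) (hF0 p)
  have hqle : qSumV X.card ((G \ coloops M G) \ X).card i₀ j₀ E cnt v ≤
      ∑ T ∈ 𝒯, F (profileAt (coloops M G) X T) := by
    rw [hq]
    refine le_trans (Finset.sum_le_sum hge) (le_trans (le_of_eq ?_) hfib)
    apply Finset.sum_congr rfl
    intro p hp
    exact (hfib' p hp).symm
  have hinc' : D ≤ lossIncomeH M 5 G (fun B => 5 ≤ (B \ coloops M G).card) (dshMissed M 5 G) B z := by
    calc D = D * 1 := by ring
      _ ≤ D * qSumV X.card ((G \ coloops M G) \ X).card i₀ j₀ E cnt v :=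
          mul_le_mul_of_nonneg_left hsum hDpos.le
      _ ≤ D * ∑ T ∈ 𝒯, F (profileAt (coloops M G) X T) :=
          mul_le_mul_of_nonneg_left hqle hDpos.le
      _ = ∑ T ∈ 𝒯, vT T / u T := hsum1.symm
      _ ≤ _ := hinc
  rw [hrho]
  have hl1 : 0 ≤ loss M 5 G B z := loss_nonneg' hG hd' B z
  calc loss M 5 G B z = loss M 5 G B z / D * D := by field_simp
    _ ≤ loss M 5 G B z / D * lossIncomeH M 5 G (fun B => 5 ≤ (B \ coloops M G).card) (dshMissed M 5 G) B z :=
        mul_le_mul_of_nonneg_left hinc' (div_nonneg hl1 hDpos.le)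

end TwoOneAssembly

end PercRepro.Shadow
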